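import Summits.KontsevichZagierPeriods.KontsevichZagierPeriods.Theorems.HermiteRigidityAssembly
import Summits.KontsevichZagierPeriods.KontsevichZagierPeriods.Theorems.HermiteRigidityReductionRigidityOfKernelForm
import Literature.NumberTheory.Transcendental.KZKernelConjectureForms
import Summits.KontsevichZagierPeriods.KontsevichZagierPeriods.Theorems.HermiteRigidityEllipticMomentKernel
import Summits.KontsevichZagierPeriods.KontsevichZagierPeriods.Theorems.HermiteRigidityGenusTwoCycleTransfer

/-!
# Crux-strategist sketch for `ReductionRigidity` (stmt-KontsevichZagierPeriods-3407, route HermiteRigidity)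

Kernel-checked content behind `STRATEGY-CENSUS.md` (planner-cstrat-stmt-KontsevichZagierPeriods-3407-0,
2026-08-16). Nothing here is a new line: the file TYPES the four census attempts and proves the
bookkeeping implications that show where each attempt lands.

* §S  STRENGTHEN — `KernelFormDimBounded` (dimension-bounded move chains, the induction-friendly
  strengthening) and `kernelFormDimBounded_implies_crux`.
* §D  DECOMPOSITION — every typed split of the summit already filed on the hub is verbatim a split
  of this crux (routing lemmas `split_of_closes₂/₃`, `piece_of_crux`, instances D0–D2 in the docstring;
  `split_ownSectors`), and in each the complement / transcendence piece is crux-equivalent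
  (`ellipticSectorComplement_iff_crux`, `sectorKernelUpToTorsion_of_crux`).
* §N  NEGATION — `invariantsComplete_iff_crux`: "every additive invariant of the four move sets
  factors through `eval` on `ker eval`" is literally equivalent to the crux, i.e. the obstruction
  met by every counterexample attempt (no invariant finer than `eval` is known) dualises to the
  crux itself and yields no stub.
-/

noncomputable section

set_option linter.dupNamespace false

namespace Summit.KontsevichZagierPeriods.KontsevichZagierPeriods.Cruxes.ReductionRigidity.Strategy

open Literature.NumberTheory.Transcendental
open Summit.KontsevichZagierPeriods.KontsevichZagierPeriods.Theses.HermiteRigidity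
/-! ## §0  The kernel form, inlined (never the `@[conjecture]` constant) -/

/-- Conjecture 1 in kernel form, inlined. -/
def KernelForm : Prop := ∀ c : KZ.FormalRep, KZ.eval c = 0 → c ∈ KZ.relations

theorem crux_of_kernelForm (h : KernelForm) : ReductionRigidity :=
  Summit.KontsevichZagierPeriods.HermiteRigidity.ReductionRigidityOfKernelForm.reductionRigidityOfKernelForm_proof h

/-- crux ⇒ summit: the landed assembly (= the route's `closes` fed with the landed `RigidKernel`). -/
theorem kontsevichZagierPeriods_of_reductionRigidity (h : ReductionRigidity) : _root_.KontsevichZagierPeriods :=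
  Summit.KontsevichZagierPeriods.HermiteRigidity.Assembly.assembly_proof h

theorem kernelForm_of_crux (h : ReductionRigidity) : KernelForm := fun c hc =>
  (kzKernelConjecture_iff_isRational.mpr (kontsevichZagierPeriods_of_reductionRigidity h)) c hc

/-- summit ⇒ crux (kernel form inlined; same content as the landed
`reductionRigidity_of_kontsevichZagierPeriods` of Theorems/HermiteRigidityReductionRigidityFrame.lean, re-derived here to
keep this file's imports inside the HermiteRigidity cone). -/
theorem reductionRigidity_of_kontsevichZagierPeriods (h : _root_.KontsevichZagierPeriods) : ReductionRigidity :=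
  crux_of_kernelForm fun c hc => (kzKernelConjecture_iff_isRational.mpr h) c hc

theorem crux_iff_summit : ReductionRigidity ↔ _root_.KontsevichZagierPeriods :=
  ⟨kontsevichZagierPeriods_of_reductionRigidity, reductionRigidity_of_kontsevichZagierPeriods⟩

theorem kernelForm_iff_crux : KernelForm ↔ ReductionRigidity := ⟨crux_of_kernelForm, kernelForm_of_crux⟩

/-! ## §S  STRENGTHEN: dimension-bounded chains (over the tree's dimension filtration
`KZ.formalRepLE d` / truncated relations `KZ.relationsLE d` of `KZRelationsLE.lean`) -/

/-- The four move sets. -/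
def moves : Set KZ.FormalRep :=
  KZ.domainAddRel ∪ KZ.integrandAddRel ∪ KZ.changeOfVariablesRel ∪ KZ.newtonLeibnizRel

/-- **S⁺ (dimension-bounded kernel form).** There is a detour bound `δ` such that every vanishing
`ℤ`-combination of representations of dimension `≤ d` is a consequence of move instances among
representations of dimension `≤ d + δ d` (`KZ.relationsLE`). Strictly stronger than the kernel
form (`KZ.relations = ⨆ d, KZ.relationsLE d`, `KZ.relations_eq_iSup_relationsLE`, allows detours
of any dimension); the form of the crux that WOULD admit induction on `d`. -/
def KernelFormDimBounded : Prop :=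
  ∃ δ : ℕ → ℕ, ∀ (d : ℕ), ∀ c ∈ KZ.formalRepLE d, KZ.eval c = 0 → c ∈ KZ.relationsLE (d + δ d)

/-- Every formal combination is supported in bounded dimension (finite support). -/
theorem exists_mem_formalRepLE (c : KZ.FormalRep) : ∃ d, c ∈ KZ.formalRepLE d := by
  induction c using FreeAbelianGroup.induction_on with
  | zero => exact ⟨0, zero_mem _⟩
  | of x =>
      obtain ⟨n, r⟩ := x
      exact ⟨n, KZ.of_mem_formalRepLE r le_rfl⟩
  | neg x hx =>
      obtain ⟨d, hd⟩ := hx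
      exact ⟨d, neg_mem hd⟩
  | add x y hx hy =>
      obtain ⟨d₁, h₁⟩ := hx
      obtain ⟨d₂, h₂⟩ := hy
      exact ⟨max d₁ d₂, add_mem (KZ.formalRepLE_mono (le_max_left _ _) h₁)
        (KZ.formalRepLE_mono (le_max_right _ _) h₂)⟩

/-- S⁺ ⇒ kernel form ⇒ crux (the routine direction of the inventor's paradox). -/
theorem kernelFormDimBounded_implies_crux (h : KernelFormDimBounded) : ReductionRigidity := by
  obtain ⟨δ, hδ⟩ := h
  refine crux_of_kernelForm fun c hc => ?_
  obtain ⟨d, hd⟩ := exists_mem_formalRepLE c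
  exact KZ.relationsLE_le_relations _ (hδ d c hd hc)

/-! ## §D  DECOMPOSITION: every filed split of the summit is verbatim a split of the crux -/

/-- ROUTING LEMMAS — every deciding theorem `closes : X₁ → … → X_k → KontsevichZagierPeriods` of
ANY route of the summit is verbatim a k-piece split of this crux, and every piece the summit
implies is implied back by the crux ("the piece that remains the whole crux"). Instances, all
checked in the session copy of this file (`Sketch.lean`, attached as evidence on stmt-3407, rc 0
against the route files themselves; those imports are omitted HERE only because the farm's oleans
of two freshly edited route files were incoherent at publication time):
* D0 frame: `SymplecticScissors.VolumeForm → ReductionRigidity` = landed `reductionRigidity_of_volumeForm`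
  (Theorems/HermiteRigidityReductionRigidityFrame.lean); one piece, 3814 = summit.
* D1 π-localisation: `split_of_closes₂ AyoubSpecialisation.closes :
  AyoubPiCancellation (0540) → AyoubPiLocalKernel (0541) → ReductionRigidity`.
* D2 resolved sector: `split_of_closes₃ VeryGoodTransfer.closes :
  RationalRepsResolve (5089) → ResolvedRepsKernel (7967) → TorsionFree (3169) → ReductionRigidity`, and
  `ReductionRigidity → ResolvedRepsKernel` (multiplier `m = 1`, via `kernelForm_of_crux`). -/
theorem split_of_closes₂ {X₁ X₂ : Prop} (closes : X₁ → X₂ → _root_.KontsevichZagierPeriods) :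
    X₁ → X₂ → ReductionRigidity :=
  fun h₁ h₂ => reductionRigidity_of_kontsevichZagierPeriods (closes h₁ h₂)

theorem split_of_closes₃ {X₁ X₂ X₃ : Prop} (closes : X₁ → X₂ → X₃ → _root_.KontsevichZagierPeriods) :
    X₁ → X₂ → X₃ → ReductionRigidity :=
  fun h₁ h₂ h₃ => reductionRigidity_of_kontsevichZagierPeriods (closes h₁ h₂ h₃)

theorem piece_of_crux {X : Prop} (h : _root_.KontsevichZagierPeriods → X) : ReductionRigidity → X :=
  fun hc => h (kontsevichZagierPeriods_of_reductionRigidity hc)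

/-- The generic shape of "the piece that remains the whole crux": a kernel statement on any
sub-sector `S` with integer multipliers (VeryGoodTransfer's `ResolvedRepsKernel` is the instance
`S` = resolved representations) is implied by the crux with `m = 1`. -/
theorem sectorKernelUpToTorsion_of_crux (S : Set KZ.FormalRep) (h : ReductionRigidity) :
    ∀ c ∈ AddSubgroup.closure S, KZ.eval c = 0 → ∃ m : ℕ, m ≠ 0 ∧ m • c ∈ KZ.relations :=
  fun c _ hc => ⟨1, one_ne_zero, by simpa using kernelForm_of_crux h c hc⟩

/-- D3 — this route's own sector split: with GenusTwoCycleTransfer and EllipticMomentKernel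
PROVED, the crux is `RealEllipticSectorKernel` (10632, genuine) + `EllipticSectorComplement`
(14724, the remainder). -/
theorem split_ownSectors : RealEllipticSectorKernel → EllipticSectorComplement → ReductionRigidity :=
  fun h₄ hC => hC
    Summit.KontsevichZagierPeriods.HermiteRigidity.GenusTwoCycleTransfer.GenusTwoCycleTransfer_proof
    Summit.KontsevichZagierPeriods.HermiteRigidity.EllipticMomentKernel.EllipticMomentKernel_of h₄

/-- … and the remainder IS the crux (given the sector theorems it is literally equivalent). -/
theorem ellipticSectorComplement_iff_crux (h₄ : RealEllipticSectorKernel) :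
    EllipticSectorComplement ↔ ReductionRigidity :=
  ⟨fun hC => split_ownSectors h₄ hC, fun h _ _ _ => h⟩

/-! ## §N  NEGATION: the obstruction dualised is the crux -/

/-- "The move-invariants are complete": every additive invariant of the four move sets vanishes on
`ker eval` (equivalently: factors through `eval` there). A counterexample to the crux is exactly an
invariant violating this (`NegObstructionShape`, Disproof §6). -/
def InvariantsComplete : Prop :=
  ∀ (A : Type) [AddCommGroup A] (φ : KZ.FormalRep →+ A),
    (∀ g ∈ moves, φ g = 0) → ∀ c : KZ.FormalRep, KZ.eval c = 0 → φ c = 0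

/-- **The negation obstruction is the crux in dual dress**: completeness of the move-invariants is
literally equivalent to `ReductionRigidity` (universal invariant = the quotient map). -/
theorem invariantsComplete_iff_crux : InvariantsComplete ↔ ReductionRigidity := by
  constructor
  · intro h
    refine crux_of_kernelForm fun c hc => ?_
    have hφ : ∀ g ∈ moves, QuotientAddGroup.mk' KZ.relations g = 0 := fun g hg =>
      (QuotientAddGroup.eq_zero_iff g).mpr (AddSubgroup.subset_closure hg)
    exact (QuotientAddGroup.eq_zero_iff c).mp (h _ (QuotientAddGroup.mk' KZ.relations) hφ c hc)
  · intro h A _ φ hφ c hc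
    have hker : KZ.relations ≤ φ.ker := (AddSubgroup.closure_le _).mpr fun g hg => hφ g hg
    exact hker (kernelForm_of_crux h c hc)

end Summit.KontsevichZagierPeriods.KontsevichZagierPeriods.Cruxes.ReductionRigidity.Strategy

/-! ## §N′  A pruning remark for the invariant hunt (stated, NOT proved here)

Proof sketch (packing): for `0 ≤ f` on `σ` and rationals `q₁ < value < q₂`, fine rational grids
dissect the subgraph of `f` (rule 3 unfolding + rule 1a) into cells that translate (rule 2) into,
resp. out of, rational boxes of volumes `q₁`, `q₂`; a monotone invariant `φ` therefore satisfies
`q₁ φ[□] ≤ φ[r] ≤ q₂ φ[□]`, hence `φ = φ[□] • eval` on non-negative representations and, by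
(1b), everywhere. Consequence for route Neg / the disprover: a SEPARATING invariant is necessarily
sign-indefinite on non-negative representations (it cannot be a "measure"). -/

namespace Summit.KontsevichZagierPeriods.KontsevichZagierPeriods.Cruxes.ReductionRigidity.Strategy

open Literature.NumberTheory.Transcendental

/-- Monotone move-invariants are multiples of `eval` (remark; proof = packing, not formalised). -/
def MonotoneInvariantsAreVolumes : Prop :=
  ∀ φ : KZ.FormalRep →+ ℝ, (∀ g ∈ moves, φ g = 0) →
    (∀ (n : ℕ) (r : KZ.IntegralRep n), (∀ x ∈ r.domain, 0 ≤ r.integrand x) → 0 ≤ φ (KZ.of r)) →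
    ∃ c : ℝ, ∀ x : KZ.FormalRep, φ x = c * KZ.eval x

end Summit.KontsevichZagierPeriods.KontsevichZagierPeriods.Cruxes.ReductionRigidity.Strategy
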